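import Literature.NumberTheory.Automorphic.UnitaryGroupIsotropicFrameAction       -- ★ `hermForm` algebra (`hermForm_add_right`, `_smul_right`, `_smul_left_eq`, `_sum_right`)
import Literature.NumberTheory.Automorphic.UnitaryGroupFormTransport              -- ★ `formCongr T H = (σT)ᵀ H T`
import HarnessLib

/-!
# Crux `H413`, programme P2, N3 road (S2)-b part 2b — THE HYPERBOLIC FRAME OF A FORM CONGRUENCE `ᵗ(σT) H T = a Φ₃` AND HOW `T n T⁻¹` MOVES IT;
# tensoring with a hermitian LINE

Cell hodgecm-mathlib (D-0151), FLOOR 0, crux item H413 = stmt-HodgeConjecture-24833, programme P2; N3 road (`F0/P2/B-p18/g28/N3-ROAD.v1.B-p18g28.md`)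
§2 (S2), desk F0P2-plan (g8) 18:45:24Z «(S2)-b TRANSPORT».  Seat A-p12 (g17); sequel of parts 1 (★ p831536 `F0P2oParabolicLineChartDocking`) and 2a
(`F0P2oFrameStabiliserYTriviality`).  THEOREMS ONLY (no `def`, no instance, no notation, no named fact, no `sorry`); never imports a `Cruxes/…/Lines`
module; kernel lane `--supports stmt-HodgeConjecture-24833 --as helper`.  HC_CM is proved only modulo the printed citations until rung 0 closes; nothing
printed is asserted here.

THE DOCKING DATA.  ★ `GelbartRogawski1991.xThetaGqsCM` reads the theta type on `U(Φ₃)(L⁺_v)` along a form congruence `h : formCongr σ T H = a • Φ₃`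
(`H = diag dV ⊗ 1`, `T ∈ GL₃`, `a` a unit; the Borel of `U(Φ₃)` acts on `U(H)` by `n ↦ T n T⁻¹`, ★ `coe_cmDatumLocalCongr_apply`).  Part 2a consumes, for the
frame chart of ★ `exists_frameChart`, a HYPERBOLIC FRAME `(x₀, y₀, b₀)` and the action of `g⁻¹ = T n⁻¹ T⁻¹` on it.  This file produces both from `h`,
over ANY commutative ring `S` with `σ`:

* §1 the COLUMNS `cᵢ = T eᵢ` of `T` pair by the congruent form: `B(cᵢ, cⱼ) = (formCongr σ T H) i j` (`hermForm_col_col`), hence for `h : formCongr = a • A`,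
  `A = antidiag(1,1,1)`: the frame **`x₀ = c₀`, `b₀ = c₁`, `y₀ = a⁻¹ c₂`** is hyperbolic — `B(x₀,x₀) = B(y₀,y₀) = 0`, `B(x₀,y₀) = B(y₀,x₀) = 1`, `b₀ ⊥ x₀, y₀`,
  `B(b₀,b₀) = a` (`hermForm_frame_*`), with the expansion `v = B(y₀,v) x₀ + B(x₀,v) y₀ + a⁻¹ B(b₀,v) b₀` (`frame_expansion`; `T` invertible, `σ a = a`).
* §2 **`conj_mulVec_col`**: `(T m T⁻¹) cⱼ = Σᵢ mᵢⱼ cᵢ` — so for `m = n⁻¹ = u(−x, −y, xy − z)` upper unitriangular: `g⁻¹ x₀ = x₀`, `g⁻¹ b₀ = b₀ + (−x) x₀`,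
  `g⁻¹ y₀ = y₀ + (−y a⁻¹) b₀ + ((xy − z) a⁻¹) x₀` (`conj_upper_mulVec_*`; the CENTRE `x = y = 0`: `g⁻¹ y₀ = y₀ + (−z a⁻¹) x₀`, `g⁻¹ b₀ = b₀`), and for
  `m = diag(d)`: `g⁻¹ cⱼ = dⱼ cⱼ` (`conj_diagonal_mulVec_col`) — EXACTLY the hypotheses `hx0` ∕ `hb` ∕ `hy0` of part 2a's three theorems.
* §3 TENSORING WITH A LINE (`e : Fin N × Fin 1 ≃ Fin n′`, the pair space of ★ `localLineInl`, `k ↦ reindex e (k ⊗ 1)`): for any linear `L` with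
  `L x k = x (e⁻¹ k).1` («`x ⊗ w₀`»): `reindex e (g ⊗ 1) · L x = L (g x)` (`reindex_kronecker_one_mulVec`) and
  `B_{reindex e (J_V ⊗ J_W)}(L x, L y) = B_{J_V}(x, y) · (J_W)₀₀` (`hermForm_reindex_kronecker`) — so the frame and the frame action lift to the pair space
  verbatim, the pairings scaled by the unit `(J_W)₀₀ = ε`.
[MoeglinVignerasWaldspurger1987, Chap. 1 I.17, Chap. 3 §IV.2; Rogawski1990, §1.9–1.10; Dieudonne1971GroupesClassiques, Chap. II §5; PlatonovRapinchuk1994, §2.3.]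

## References
* [MoeglinVignerasWaldspurger1987] C. Mœglin, M.-F. Vignéras, J.-L. Waldspurger, *Correspondances de Howe sur un corps p-adique*, LNM 1291 (1987): Chap. 1 I.17 (dual
  pairs `U(V) × U(W) ⊂ Sp(V ⊗ W)`), Chap. 3 §IV.2 (mixed model along an isotropic line).
* [Rogawski1990] J. D. Rogawski, Ann. of Math. Stud. 123 (1990): §1.9 p. 8 (`Φ₃`), §1.10 p. 9 (`B = MN`).
* [Dieudonne1971GroupesClassiques] J. Dieudonné, *La géométrie des groupes classiques* (1971): Chap. II §5 (hyperbolic pairs and frames).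
* [PlatonovRapinchuk1994] V. Platonov, A. Rapinchuk, *Algebraic Groups and Number Theory* (1994): §2.3 (forms and change of basis).
-/

set_option autoImplicit false
set_option linter.dupNamespace false -- the mandated namespace repeats the single-problem summit's segment

open scoped MatrixGroups Kronecker
open _root_.Matrix
open Literature.NumberTheory.Automorphic Literature.NumberTheory.Automorphic.UnitaryGroup

namespace Summit.HodgeConjecture.HodgeConjecture.Cruxes.H413.F0P2oFrameOfFormCongruence

/-! ## §1 The columns of a form congruence are a hyperbolic frame -/

section Frame

variable {S : Type*} [CommRing S] (σ : S →+* S) {k : Type*} [Fintype k] [DecidableEq k] (H : Matrix k k S) (T : GL k S)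

/-- **the columns of `T` pair by the congruent form**: `B_H(T eᵢ, T eⱼ) = ((σT)ᵀ H T) i j`. [cite: PlatonovRapinchuk1994, §2.3] -/
theorem hermForm_col_col (i j : k) :
    hermForm σ H ((T : Matrix k k S).col i) ((T : Matrix k k S).col j) = formCongr σ T H i j := by
  rw [hermForm_apply, formCongr, Matrix.mul_apply]
  simp only [dotProduct, Matrix.mulVec, Function.comp_apply, Matrix.col_apply, Matrix.mul_apply, Matrix.transpose_apply,
    Matrix.map_apply, Finset.mul_sum, Finset.sum_mul]
  rw [Finset.sum_comm]
  exact Finset.sum_congr rfl fun l _ => Finset.sum_congr rfl fun m _ => by ring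

/-- **every vector is a combination of the columns of `T`** with coefficients `T⁻¹ v`: `v = Σᵢ (T⁻¹ v)ᵢ • T eᵢ`. [cite: PlatonovRapinchuk1994, §2.3] -/
theorem eq_sum_inv_mulVec_smul_col (v : k → S) :
    v = ∑ i, (((T⁻¹ : GL k S) : Matrix k k S) *ᵥ v) i • (T : Matrix k k S).col i := by
  conv_lhs => rw [← Matrix.one_mulVec v, ← Units.val_one, ← mul_inv_cancel T, Units.val_mul, ← Matrix.mulVec_mulVec,
    Matrix.mulVec_eq_sum]
  exact Finset.sum_congr rfl fun i _ => by rw [op_smul_eq_smul]; rfl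

/-- **conjugates act on the columns through the matrix**: `(T m T⁻¹) (T eⱼ) = Σᵢ mᵢⱼ • T eᵢ`. [cite: PlatonovRapinchuk1994, §2.3] -/
theorem conj_mulVec_col (m : Matrix k k S) (j : k) :
    ((T : Matrix k k S) * m * ((T⁻¹ : GL k S) : Matrix k k S)) *ᵥ (T : Matrix k k S).col j = ∑ i, m i j • (T : Matrix k k S).col i := by
  rw [← Matrix.mulVec_single_one, Matrix.mulVec_mulVec, Matrix.mul_assoc, Matrix.mul_assoc, ← Units.val_mul, inv_mul_cancel,
    Units.val_one, Matrix.mul_one, ← Matrix.mulVec_mulVec, Matrix.mulVec_single_one, Matrix.mulVec_eq_sum]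
  exact Finset.sum_congr rfl fun i _ => by rw [op_smul_eq_smul]; rfl

/-- **diagonal conjugates scale the columns**: `(T diag(d) T⁻¹) (T eⱼ) = dⱼ • T eⱼ`. [cite: Rogawski1990, §1.10 p. 9] -/
theorem conj_diagonal_mulVec_col (d : k → S) (j : k) :
    ((T : Matrix k k S) * Matrix.diagonal d * ((T⁻¹ : GL k S) : Matrix k k S)) *ᵥ (T : Matrix k k S).col j = d j • (T : Matrix k k S).col j := by
  rw [conj_mulVec_col, Finset.sum_eq_single j]
  · rw [Matrix.diagonal_apply_eq]
  · intro i _ hij; rw [Matrix.diagonal_apply_ne _ hij, zero_smul]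
  · intro hj; exact absurd (Finset.mem_univ j) hj

end Frame

section FrameThree

variable {S : Type*} [CommRing S] (σ : S →+* S) (H : Matrix (Fin 3) (Fin 3) S) (T : GL (Fin 3) S) {A : Matrix (Fin 3) (Fin 3) S} (a : Sˣ)
  (hA : ∀ i j : Fin 3, A i j = if i.val + j.val + 1 = 3 then 1 else 0) (h : formCongr σ T H = (a : S) • A)

include hA h in
/-- the pairings of the columns: `B(T eᵢ, T eⱼ) = a · [i + j = 2]` (`Φ₃ = antidiag(1,1,1)`, ★ `Rogawski1990.qsForm`). [cite: Rogawski1990, §1.9 p. 8] -/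
theorem hermForm_col_col_eq (i j : Fin 3) :
    hermForm σ H ((T : Matrix (Fin 3) (Fin 3) S).col i) ((T : Matrix (Fin 3) (Fin 3) S).col j) = if i.val + j.val + 1 = 3 then (a : S) else 0 := by
  rw [hermForm_col_col, h, Matrix.smul_apply, hA, smul_eq_mul, mul_ite, mul_one, mul_zero]

include hA h in
/-- **`x₀ = T e₀` is isotropic.** [cite: Dieudonne1971GroupesClassiques, Chap. II §5] -/
theorem hermForm_frame_xx : hermForm σ H ((T : Matrix (Fin 3) (Fin 3) S).col 0) ((T : Matrix (Fin 3) (Fin 3) S).col 0) = 0 := by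
  rw [hermForm_col_col_eq σ H T a hA h]; rfl

include hA h in
/-- **`y₀ = a⁻¹ T e₂` is isotropic.** [cite: Dieudonne1971GroupesClassiques, Chap. II §5] -/
theorem hermForm_frame_yy :
    hermForm σ H (((a⁻¹ : Sˣ) : S) • (T : Matrix (Fin 3) (Fin 3) S).col 2) (((a⁻¹ : Sˣ) : S) • (T : Matrix (Fin 3) (Fin 3) S).col 2) = 0 := by
  rw [hermForm_smul_right, hermForm_smul_left_eq, hermForm_col_col_eq σ H T a hA h]
  simp

include hA h in
/-- **`B(x₀, y₀) = 1`.** [cite: Dieudonne1971GroupesClassiques, Chap. II §5] -/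
theorem hermForm_frame_xy : hermForm σ H ((T : Matrix (Fin 3) (Fin 3) S).col 0) (((a⁻¹ : Sˣ) : S) • (T : Matrix (Fin 3) (Fin 3) S).col 2) = 1 := by
  rw [hermForm_smul_right, hermForm_col_col_eq σ H T a hA h]
  simp

/-- `σ (a⁻¹) = a⁻¹` for a `σ`-fixed unit `a`. [folklore] -/
theorem map_units_inv_of_map_eq {a : Sˣ} (hσa : σ (a : S) = a) : σ ((a⁻¹ : Sˣ) : S) = ((a⁻¹ : Sˣ) : S) := by
  have h1 : σ ((a⁻¹ : Sˣ) : S) * (a : S) = 1 := by rw [← hσa, ← map_mul, Units.inv_mul, map_one]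
  calc σ ((a⁻¹ : Sˣ) : S) = σ ((a⁻¹ : Sˣ) : S) * ((a : S) * ((a⁻¹ : Sˣ) : S)) := by rw [Units.mul_inv, mul_one]
    _ = ((a⁻¹ : Sˣ) : S) := by rw [← mul_assoc, h1, one_mul]

include hA h in
/-- **`σ a = a`**: the congruent form of a HERMITIAN form is hermitian (`σ B(x, y) = B(y, x)`, ★ `conj_hermForm`), and `a = B(T e₀, T e₂)`,
`B(T e₂, T e₀) = a`. [cite: PlatonovRapinchuk1994, §2.3] -/
theorem map_unit_eq (hσσ : ∀ s, σ (σ s) = s) (hH : (H.map σ)ᵀ = H) : σ (a : S) = a := by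
  have h02 := hermForm_col_col_eq σ H T a hA h 0 2
  have h20 := hermForm_col_col_eq σ H T a hA h 2 0
  simp only [Fin.isValue, Fin.val_zero, Fin.val_two, zero_add, Nat.reduceAdd, ↓reduceIte, add_zero] at h02 h20
  rw [← h02, conj_hermForm σ H hσσ hH, h20]
  exact h02.symm

include hA h in
/-- **`B(y₀, x₀) = 1`** (`σ a = a`). [cite: Dieudonne1971GroupesClassiques, Chap. II §5] -/
theorem hermForm_frame_yx (hσa : σ (a : S) = a) :
    hermForm σ H (((a⁻¹ : Sˣ) : S) • (T : Matrix (Fin 3) (Fin 3) S).col 2) ((T : Matrix (Fin 3) (Fin 3) S).col 0) = 1 := by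
  rw [hermForm_smul_left_eq, map_units_inv_of_map_eq σ hσa, hermForm_col_col_eq σ H T a hA h]
  simp

include hA h in
/-- **`b₀ = T e₁` is orthogonal to `x₀` and `y₀`** (both orders). [cite: Dieudonne1971GroupesClassiques, Chap. II §5] -/
theorem hermForm_frame_orth :
    hermForm σ H ((T : Matrix (Fin 3) (Fin 3) S).col 0) ((T : Matrix (Fin 3) (Fin 3) S).col 1) = 0 ∧
    hermForm σ H ((T : Matrix (Fin 3) (Fin 3) S).col 1) ((T : Matrix (Fin 3) (Fin 3) S).col 0) = 0 ∧
    hermForm σ H (((a⁻¹ : Sˣ) : S) • (T : Matrix (Fin 3) (Fin 3) S).col 2) ((T : Matrix (Fin 3) (Fin 3) S).col 1) = 0 ∧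
    hermForm σ H ((T : Matrix (Fin 3) (Fin 3) S).col 1) (((a⁻¹ : Sˣ) : S) • (T : Matrix (Fin 3) (Fin 3) S).col 2) = 0 := by
  refine ⟨?_, ?_, ?_, ?_⟩
  · rw [hermForm_col_col_eq σ H T a hA h]; rfl
  · rw [hermForm_col_col_eq σ H T a hA h]; rfl
  · rw [hermForm_smul_left_eq, hermForm_col_col_eq σ H T a hA h]; simp
  · rw [hermForm_smul_right, hermForm_col_col_eq σ H T a hA h]; simp

include hA h in
/-- **`B(b₀, b₀) = a`** (the anisotropic middle line; `a = φ(a₀)` real in the CM application). [cite: Dieudonne1971GroupesClassiques, Chap. II §5] -/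
theorem hermForm_frame_bb : hermForm σ H ((T : Matrix (Fin 3) (Fin 3) S).col 1) ((T : Matrix (Fin 3) (Fin 3) S).col 1) = a := by
  rw [hermForm_col_col_eq σ H T a hA h]; rfl

include hA h in
/-- the three frame functionals on `v = Σ cᵢ T eᵢ`: `B(y₀, v) = c₀`, `B(x₀, v) = c₂ a`, `B(b₀, v) = c₁ a` (`c = T⁻¹ v`, `σ a = a`).
[cite: Dieudonne1971GroupesClassiques, Chap. II §5] -/
theorem hermForm_frame_apply (hσa : σ (a : S) = a) (v : Fin 3 → S) :
    hermForm σ H (((a⁻¹ : Sˣ) : S) • (T : Matrix (Fin 3) (Fin 3) S).col 2) v = (((T⁻¹ : GL (Fin 3) S) : Matrix (Fin 3) (Fin 3) S) *ᵥ v) 0 ∧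
    hermForm σ H ((T : Matrix (Fin 3) (Fin 3) S).col 0) v = (((T⁻¹ : GL (Fin 3) S) : Matrix (Fin 3) (Fin 3) S) *ᵥ v) 2 * a ∧
    hermForm σ H ((T : Matrix (Fin 3) (Fin 3) S).col 1) v = (((T⁻¹ : GL (Fin 3) S) : Matrix (Fin 3) (Fin 3) S) *ᵥ v) 1 * a := by
  have hv := eq_sum_inv_mulVec_smul_col T v
  set c := ((T⁻¹ : GL (Fin 3) S) : Matrix (Fin 3) (Fin 3) S) *ᵥ v with hc
  have hcc := hermForm_col_col_eq σ H T a hA h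
  refine ⟨?_, ?_, ?_⟩
  · conv_lhs => rw [hv]
    rw [hermForm_sum_right, Fin.sum_univ_three]
    simp only [hermForm_smul_right, hermForm_smul_left_eq, map_units_inv_of_map_eq σ hσa, hcc]
    simp
  · conv_lhs => rw [hv]
    rw [hermForm_sum_right, Fin.sum_univ_three]
    simp only [hermForm_smul_right, hcc]
    simp
  · conv_lhs => rw [hv]
    rw [hermForm_sum_right, Fin.sum_univ_three]
    simp only [hermForm_smul_right, hcc]
    simp

include hA h in
/-- **THE FRAME EXPANSION** (hypothesis `hexp` of ★ `exists_frameChart`): `v = B(y₀,v) • x₀ + B(x₀,v) • y₀ + (a⁻¹ B(b₀,v)) • b₀`.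
[cite: Dieudonne1971GroupesClassiques, Chap. II §5] -/
theorem frame_expansion (hσa : σ (a : S) = a) (v : Fin 3 → S) :
    v = hermForm σ H (((a⁻¹ : Sˣ) : S) • (T : Matrix (Fin 3) (Fin 3) S).col 2) v • (T : Matrix (Fin 3) (Fin 3) S).col 0 +
      hermForm σ H ((T : Matrix (Fin 3) (Fin 3) S).col 0) v • (((a⁻¹ : Sˣ) : S) • (T : Matrix (Fin 3) (Fin 3) S).col 2) +
      (((a⁻¹ : Sˣ) : S) * hermForm σ H ((T : Matrix (Fin 3) (Fin 3) S).col 1) v) • (T : Matrix (Fin 3) (Fin 3) S).col 1 := by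
  obtain ⟨h0, h2, h1⟩ := hermForm_frame_apply σ H T a hA h hσa v
  rw [h0, h2, h1, smul_smul, Units.mul_inv_cancel_right, mul_left_comm, Units.inv_mul, mul_one]
  conv_lhs => rw [eq_sum_inv_mulVec_smul_col T v, Fin.sum_univ_three]
  abel

end FrameThree

/-! ## §2 How `T n T⁻¹` moves the frame for `n` upper unitriangular or diagonal -/

section Upper

variable {S : Type*} [CommRing S] (T : GL (Fin 3) S) (a : Sˣ)

/-- **`g⁻¹ = T u(x′, y′, z′) T⁻¹` on the frame** for an upper unitriangular `u(x′, y′, z′) = !![1, x′, z′; 0, 1, y′; 0, 0, 1]` (for `g = T n T⁻¹`,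
`n = u(x, y, z)`: `n⁻¹ = u(−x, −y, xy − z)`, ★ p831536 `coe_inv_upper`): `x₀ ↦ x₀`, `b₀ ↦ b₀ + x′ x₀`, `y₀ ↦ y₀ + (y′ a⁻¹) b₀ + (z′ a⁻¹) x₀` — the hypotheses
`hx0`, `hb`, `hy0` of part 2a. [cite: Rogawski1990, §1.10 p. 9] [cite: MoeglinVignerasWaldspurger1987, Chap. 3 §IV.2] -/
theorem conj_upper_mulVec_frame (x' y' z' : S) :
    ((T : Matrix (Fin 3) (Fin 3) S) * !![1, x', z'; 0, 1, y'; 0, 0, 1] * ((T⁻¹ : GL (Fin 3) S) : Matrix (Fin 3) (Fin 3) S)) *ᵥ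
        (T : Matrix (Fin 3) (Fin 3) S).col 0 = (T : Matrix (Fin 3) (Fin 3) S).col 0 ∧
    ((T : Matrix (Fin 3) (Fin 3) S) * !![1, x', z'; 0, 1, y'; 0, 0, 1] * ((T⁻¹ : GL (Fin 3) S) : Matrix (Fin 3) (Fin 3) S)) *ᵥ
        (T : Matrix (Fin 3) (Fin 3) S).col 1 = (T : Matrix (Fin 3) (Fin 3) S).col 1 + x' • (T : Matrix (Fin 3) (Fin 3) S).col 0 ∧
    ((T : Matrix (Fin 3) (Fin 3) S) * !![1, x', z'; 0, 1, y'; 0, 0, 1] * ((T⁻¹ : GL (Fin 3) S) : Matrix (Fin 3) (Fin 3) S)) *ᵥ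
        (((a⁻¹ : Sˣ) : S) • (T : Matrix (Fin 3) (Fin 3) S).col 2) =
      ((a⁻¹ : Sˣ) : S) • (T : Matrix (Fin 3) (Fin 3) S).col 2 + (y' * ((a⁻¹ : Sˣ) : S)) • (T : Matrix (Fin 3) (Fin 3) S).col 1 +
        (z' * ((a⁻¹ : Sˣ) : S)) • (T : Matrix (Fin 3) (Fin 3) S).col 0 := by
  refine ⟨?_, ?_, ?_⟩
  · rw [conj_mulVec_col, Fin.sum_univ_three]; simp
  · rw [conj_mulVec_col, Fin.sum_univ_three]; simp [add_comm]
  · rw [Matrix.mulVec_smul, conj_mulVec_col, Fin.sum_univ_three]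
    simp only [smul_add, smul_smul]
    simp
    module

/-- **a diagonal conjugate scales the frame**: `T diag(d) T⁻¹` maps `x₀ ↦ d₀ x₀`, `b₀ ↦ d₁ b₀`, `y₀ ↦ d₂ y₀` (the torus `d(α, β, (σα)⁻¹)`).
[cite: Rogawski1990, §1.10 p. 9] -/
theorem conj_diagonal_mulVec_frame (d : Fin 3 → S) :
    ((T : Matrix (Fin 3) (Fin 3) S) * Matrix.diagonal d * ((T⁻¹ : GL (Fin 3) S) : Matrix (Fin 3) (Fin 3) S)) *ᵥ
        (T : Matrix (Fin 3) (Fin 3) S).col 0 = d 0 • (T : Matrix (Fin 3) (Fin 3) S).col 0 ∧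
    ((T : Matrix (Fin 3) (Fin 3) S) * Matrix.diagonal d * ((T⁻¹ : GL (Fin 3) S) : Matrix (Fin 3) (Fin 3) S)) *ᵥ
        (T : Matrix (Fin 3) (Fin 3) S).col 1 = d 1 • (T : Matrix (Fin 3) (Fin 3) S).col 1 ∧
    ((T : Matrix (Fin 3) (Fin 3) S) * Matrix.diagonal d * ((T⁻¹ : GL (Fin 3) S) : Matrix (Fin 3) (Fin 3) S)) *ᵥ
        (((a⁻¹ : Sˣ) : S) • (T : Matrix (Fin 3) (Fin 3) S).col 2) = d 2 • (((a⁻¹ : Sˣ) : S) • (T : Matrix (Fin 3) (Fin 3) S).col 2) := by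
  refine ⟨conj_diagonal_mulVec_col T d 0, conj_diagonal_mulVec_col T d 1, ?_⟩
  rw [Matrix.mulVec_smul, conj_diagonal_mulVec_col, smul_comm]

end Upper

/-! ## §3 Tensoring with a hermitian line: `k ↦ reindex e (k ⊗ 1)` -/

section Line

variable {S : Type*} [CommRing S] (σ : S →+* S) {N n' : ℕ} (e : Fin N × Fin 1 ≃ Fin n')
  (L : (Fin N → S) →ₗ[S] (Fin n' → S)) (hL : ∀ (x : Fin N → S) (k : Fin n'), L x k = x (e.symm k).1)

include hL in
/-- **`reindex e (g ⊗ 1)` acts on `x ⊗ w₀` as `g` acts on `x`**: `(reindex e e (g ⊗ₖ 1)) *ᵥ L x = L (g *ᵥ x)`. [cite: MoeglinVignerasWaldspurger1987, Chap. 1 I.17] -/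
theorem reindex_kronecker_one_mulVec (g : Matrix (Fin N) (Fin N) S) (x : Fin N → S) :
    (Matrix.reindex e e (g ⊗ₖ (1 : Matrix (Fin 1) (Fin 1) S))) *ᵥ L x = L (g *ᵥ x) := by
  funext k
  have hone : ∀ i j : Fin 1, (1 : Matrix (Fin 1) (Fin 1) S) i j = 1 := fun i j => by rw [Subsingleton.elim i j, Matrix.one_apply_eq]
  simp only [hL, Matrix.mulVec, dotProduct, Matrix.reindex_apply, Matrix.submatrix_apply, Matrix.kroneckerMap_apply, hone, mul_one]
  exact (Fintype.sum_equiv e.symm _ (fun p : Fin N × Fin 1 => g (e.symm k).1 p.1 * x p.1) (fun l => rfl)).trans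
    (by rw [Fintype.sum_prod_type]; simp)

include hL in
/-- **the pair form on `x ⊗ w₀`, `y ⊗ w₀` is `B_V(x, y) · (J_W)₀₀`**: `hermForm σ (reindex e e (J_V ⊗ₖ J_W)) (L x) (L y) = hermForm σ J_V x y * J_W 0 0`.
[cite: MoeglinVignerasWaldspurger1987, Chap. 1 I.17] -/
theorem hermForm_reindex_kronecker (JV : Matrix (Fin N) (Fin N) S) (JW : Matrix (Fin 1) (Fin 1) S) (x y : Fin N → S) :
    hermForm σ (Matrix.reindex e e (JV ⊗ₖ JW)) (L x) (L y) = hermForm σ JV x y * JW 0 0 := by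
  have h2 : ∀ p : Fin N × Fin 1, p.2 = 0 := fun p => Fin.fin_one_eq_zero _
  simp only [hermForm_apply, dotProduct, Matrix.mulVec, Function.comp_apply, hL, Matrix.reindex_apply, Matrix.submatrix_apply,
    Matrix.kroneckerMap_apply, h2]
  have inner : ∀ i : Fin N, ∑ l, JV i (e.symm l).1 * JW 0 0 * y (e.symm l).1 = (∑ j, JV i j * y j) * JW 0 0 := fun i => by
    rw [Finset.sum_mul]
    exact (Fintype.sum_equiv e.symm _ (fun p : Fin N × Fin 1 => JV i p.1 * y p.1 * JW 0 0) (fun l => by ring)).trans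
      (by rw [Fintype.sum_prod_type]; simp)
  simp only [inner]
  rw [Finset.sum_mul]
  exact (Fintype.sum_equiv e.symm _ (fun p : Fin N × Fin 1 => σ (x p.1) * ((∑ j, JV p.1 j * y j) * JW 0 0)) (fun k => rfl)).trans
    (by rw [Fintype.sum_prod_type]; simp [mul_assoc])

end Line

end Summit.HodgeConjecture.HodgeConjecture.Cruxes.H413.F0P2oFrameOfFormCongruence
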